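import Summits.CriticalPhenomena.PercolationContinuityZ3.Theorems.Transplant.FKConnectivityAllQPat3KNetSPRecursion
import Summits.CriticalPhenomena.PercolationContinuityZ3.Theorems.Transplant.FKConnectivityAllQPat3KNetSPBridgePcD2
import Summits.CriticalPhenomena.PercolationContinuityZ3.Theorems.Transplant.FKConnectivityAllQPat3MinorAllInner
import Summits.CriticalPhenomena.PercolationContinuityZ3.Theorems.Transplant.FKConnectivityAllQPat3KNetSPLeavesClaw
import Summits.CriticalPhenomena.PercolationContinuityZ3.Theorems.Transplant.FKConnectivityAllQPat3KNetSPLeavesVee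
import Summits.CriticalPhenomena.PercolationContinuityZ3.Theorems.Transplant.FKConnectivityAllQPat3KNetSPLeavesTri
import Summits.CriticalPhenomena.PercolationContinuityZ3.Theorems.Transplant.FKConnectivityAllQPat3KNetSPLeavesPath
import HarnessLib

/-!
# Connectivity correlation inequalities for `φ_{w,q}`, every `q > 0` — THEOREM SP(𝒦) on MINORS: all marks inner; the parallel-case dispatch

Proof file (`--supports stmt-CriticalPhenomena-4575`), census lineage (gen 41) of LANE 2's FK sub-programme; builds on p205010
(kernel theorem, internal audit signed; external expert review pending).  No definitions, no named facts, no sorries.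

The 𝒦 version of census g37's «Pat3MinorAllInner»: `FK.pcK_good` (all three marks inner on one parallel part; its bridge branch is
«Pat3KNetSPBridgePcD2» `pcK_bridge_dispatch` with the leaves «Pat3KNetSPLeaves*»), the parallel-case dispatch `FK.parK_twoTerm`,
`FK.parK_oneTerm`, `FK.parK_noTerm`, `FK.parK_termFirst`, assembled in **`FK.spGoodC_parallelK`** (outer induction hypothesis `ihSP`
threaded, see «Pat3KNetSPRecursion»).  Used by «Pat3KNetTheoremSP».
[cite: AyyerLinussonRavichandran2025, §7 (p. 22)] [cite: Grimmett2006, §3.9 (pp. 63–64)]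
-/

namespace Summit.CriticalPhenomena.PercolationContinuityZ3.Theorems

namespace FK

open SimpleGraph Literature.Probability.LatticeModels Literature.Probability.Percolation
open scoped Classical

variable {V : Type*} [Fintype V]

/-! ### All marks inner on one parallel part: the recursion `pc` on minors -/

section AllInnerC

variable {F₁ F₂ E₂ : Finset (Sym2 V)} {x m y : V} {E C : Finset (Sym2 V)}

variable {N₀ : Finset (Sym2 V)}
  (ihSP : ∀ {N' E' C' : Finset (Sym2 V)} {x' y' b' s' t' : V}, N'.card < N₀.card → IsKNet N' x' y' → E' ⊆ N' → C' ⊆ N' →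
    (∃ e ∈ N', b' ∈ e) → (∃ e ∈ N', s' ∈ e) → (∃ e ∈ N', t' ∈ e) → b' ≠ s' → b' ≠ t' → s' ≠ t' → SPGoodC E' C' b' s' t')

include ihSP in
/-- All marks on the series part with the junction marked, on minors: CORNER or `pbC` after re-rooting.
[cite: AyyerLinussonRavichandran2025, §7 (p. 22)] -/
theorem pcK_junction {p q : V} (h₂ : IsKNet E₂ x y) (hd : Disjoint (F₁ ∪ F₂) E₂) (hN : F₁ ∪ F₂ ∪ E₂ ⊆ N₀)
    (hV : ∀ z : V, (∃ e ∈ F₁ ∪ F₂, z ∈ e) → (∃ e ∈ E₂, z ∈ e) → z = x ∨ z = y)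
    (hF₁ : IsKNet F₁ x m) (hF₂ : IsKNet F₂ m y) (hdF : Disjoint F₁ F₂)
    (hVF : ∀ z : V, (∃ e ∈ F₁, z ∈ e) → (∃ e ∈ F₂, z ∈ e) → z = m) (hxF₂ : ∀ e ∈ F₂, x ∉ e) (hyF₁ : ∀ e ∈ F₁, y ∉ e)
    (hE : E ⊆ F₁ ∪ F₂ ∪ E₂) (hC : C ⊆ F₁ ∪ F₂ ∪ E₂)
    (hp : ∃ e ∈ F₁ ∪ F₂, p ∈ e) (hq : ∃ e ∈ F₁ ∪ F₂, q ∈ e) (hpm : p ≠ m) (hpx : p ≠ x) (hpy : p ≠ y)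
    (hqm : q ≠ m) (hqx : q ≠ x) (hqy : q ≠ y) (hpq : p ≠ q) : SPGoodC E C m p q := by
  have iE : ∀ A : Finset (Sym2 V), E ∩ A ⊆ A := fun A => Finset.inter_subset_right
  have iC : ∀ A : Finset (Sym2 V), C ∩ A ⊆ A := fun A => Finset.inter_subset_right
  obtain ⟨hA, hdA, hVA⟩ := rerootK_serA h₂ hd hV hF₁ hF₂ hdF hVF hxF₂ hyF₁
  obtain ⟨hB, hdB, hVB⟩ := rerootK_serB h₂ hd hV hF₁ hF₂ hdF hVF hxF₂ hyF₁
  have eA : F₁ ∪ F₂ ∪ E₂ = F₁ ∪ (F₂ ∪ E₂) := Finset.union_assoc _ _ _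
  have eB : F₁ ∪ F₂ ∪ E₂ = F₂ ∪ (F₁ ∪ E₂) := by ac_rfl
  rcases span_union hp with hp1 | hp2 <;> rcases span_union hq with hq1 | hq2
  · exact pbK_good ihSP F₁.card le_rfl hF₁.symm hA hdA (subset_trans (by intro e he; clear * - he; simp only [Finset.mem_union] at he ⊢; tauto) hN) hVA (eA ▸ hE) (eA ▸ hC) hp1 hq1 hpm hpx hqm hqx hpq
  · exact (spGoodC_cornerK hdA hVA hF₁.symm hA (iE _) (iC _) (iE _) (iC _) hp1 ⟨hq2.choose, Finset.mem_union_left _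
      hq2.choose_spec.1, hq2.choose_spec.2⟩ hpm hpx hqm hqx).congr_sets (inter_union2_eq hE eA) (inter_union2_eq hC eA)
  · exact (spGoodC_cornerK hdA hVA hF₁.symm hA (iE _) (iC _) (iE _) (iC _) hq1 ⟨hp2.choose, Finset.mem_union_left _
      hp2.choose_spec.1, hp2.choose_spec.2⟩ hqm hqx hpm hpx).swap23.congr_sets (inter_union2_eq hE eA)
      (inter_union2_eq hC eA)
  · exact pbK_good ihSP F₂.card le_rfl hF₂ hB hdB (subset_trans (by intro e he; clear * - he; simp only [Finset.mem_union] at he ⊢; tauto) hN) hVB (eB ▸ hE) (eB ▸ hC) hp2 hq2 hpm hpy hqm hqy hpq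

include ihSP in
/-- **ALL MARKS INNER ON ONE PART, ON MINORS.** [cite: AyyerLinussonRavichandran2025, §7 (p. 22)] -/
theorem pcK_good : ∀ (n : ℕ) {E₁ E₂ E C : Finset (Sym2 V)} {x y b s t : V}, E₁.card ≤ n →
    IsKNet E₁ x y → IsKNet E₂ x y → Disjoint E₁ E₂ → E₁ ∪ E₂ ⊆ N₀ →
    (∀ z : V, (∃ e ∈ E₁, z ∈ e) → (∃ e ∈ E₂, z ∈ e) → z = x ∨ z = y) →
    E ⊆ E₁ ∪ E₂ → C ⊆ E₁ ∪ E₂ →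
    (∃ e ∈ E₁, b ∈ e) → (∃ e ∈ E₁, s ∈ e) → (∃ e ∈ E₁, t ∈ e) →
    b ≠ x → b ≠ y → s ≠ x → s ≠ y → t ≠ x → t ≠ y → b ≠ s → b ≠ t → s ≠ t → SPGoodC E C b s t := by
  intro n
  induction n with
  | zero =>
    intro E₁ E₂ E C x y b s t hcard h₁ _ _ _ _ _ _ _ _ _ _ _ _ _ _ _ _ _ _
    have := h₁.card_pos
    omega
  | succ n ih =>
    intro E₁ E₂ E C x y b s t hcard h₁ h₂ hd hN hV hE hC hb hs ht hbx hby hsx hsy htx hty hbs hbt hst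
    cases h₁ with
    | edge hxy =>
      obtain ⟨e, he, hse⟩ := hs
      rw [Finset.mem_singleton] at he
      subst he
      rcases Sym2.mem_iff.1 hse with h | h
      · exact absurd h hsx
      · exact absurd h hsy
    | @parallel Q₁ Q₂ _ _ hQ₁ hQ₂ hdQ hVQ =>
      have hlt1 := card_left_lt_of_parallelK hQ₂ hdQ
      have hlt2 := card_right_lt_of_parallelK hQ₁ hdQ
      obtain ⟨hP, hdP, hVP⟩ := rerootK_par h₂ hd hV hQ₂ hdQ hVQ
      obtain ⟨hP', hdP', hVP'⟩ := rerootK_par' h₂ hd hV hQ₁ hdQ hVQ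
      have eA : Q₁ ∪ Q₂ ∪ E₂ = Q₁ ∪ (Q₂ ∪ E₂) := Finset.union_assoc _ _ _
      have eB : Q₁ ∪ Q₂ ∪ E₂ = Q₂ ∪ (Q₁ ∪ E₂) := by ext e; simp only [Finset.mem_union]; tauto
      have hEA := eA ▸ hE; have hCA := eA ▸ hC; have hEB := eB ▸ hE; have hCB := eB ▸ hC
      have l1 : ∀ {p : V}, (∃ e ∈ Q₁, p ∈ e) → ∃ e ∈ Q₁ ∪ E₂, p ∈ e := fun ⟨e, he, hpe⟩ =>
        ⟨e, Finset.mem_union_left _ he, hpe⟩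
      have l2 : ∀ {p : V}, (∃ e ∈ Q₂, p ∈ e) → ∃ e ∈ Q₂ ∪ E₂, p ∈ e := fun ⟨e, he, hpe⟩ =>
        ⟨e, Finset.mem_union_left _ he, hpe⟩
      rcases span_union hb with hb1 | hb2 <;> rcases span_union hs with hs1 | hs2 <;>
        rcases span_union ht with ht1 | ht2
      · exact ih (by omega) hQ₁ hP hdP (subset_trans (by intro e he; clear * - he; simp only [Finset.mem_union] at he ⊢; tauto) hN) hVP hEA hCA hb1 hs1 ht1 hbx hby hsx hsy htx hty hbs hbt hst
      · exact (typeIK_good ihSP _ le_rfl hQ₁ hP hdP (subset_trans (by intro e he; clear * - he; simp only [Finset.mem_union] at he ⊢; tauto) hN) hVP hEA hCA hb1 hs1 (l2 ht2) hbx hby hsx hsy htx hty hbs).rotate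
      · exact (typeIK_good ihSP _ le_rfl hQ₁ hP hdP (subset_trans (by intro e he; clear * - he; simp only [Finset.mem_union] at he ⊢; tauto) hN) hVP hEA hCA hb1 ht1 (l2 hs2) hbx hby htx hty hsx hsy hbt).rotate.swap23
      · exact typeIK_good ihSP _ le_rfl hQ₂ hP' hdP' (subset_trans (by intro e he; clear * - he; simp only [Finset.mem_union] at he ⊢; tauto) hN) hVP' hEB hCB hs2 ht2 (l1 hb1) hsx hsy htx hty hbx hby hst
      · exact typeIK_good ihSP _ le_rfl hQ₁ hP hdP (subset_trans (by intro e he; clear * - he; simp only [Finset.mem_union] at he ⊢; tauto) hN) hVP hEA hCA hs1 ht1 (l2 hb2) hsx hsy htx hty hbx hby hst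
      · exact (typeIK_good ihSP _ le_rfl hQ₂ hP' hdP' (subset_trans (by intro e he; clear * - he; simp only [Finset.mem_union] at he ⊢; tauto) hN) hVP' hEB hCB hb2 ht2 (l1 hs1) hbx hby htx hty hsx hsy hbt).rotate.swap23
      · exact (typeIK_good ihSP _ le_rfl hQ₂ hP' hdP' (subset_trans (by intro e he; clear * - he; simp only [Finset.mem_union] at he ⊢; tauto) hN) hVP' hEB hCB hb2 hs2 (l1 ht1) hbx hby hsx hsy htx hty hbs).rotate
      · exact ih (by omega) hQ₂ hP' hdP' (subset_trans (by intro e he; clear * - he; simp only [Finset.mem_union] at he ⊢; tauto) hN) hVP' hEB hCB hb2 hs2 ht2 hbx hby hsx hsy htx hty hbs hbt hst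
    | @series F₁ F₂ _ m _ hF₁ hF₂ hdF hVF hxF₂ hyF₁ =>
      have hlt1 := card_left_lt_of_parallelK hF₂ hdF
      have hlt2 := card_right_lt_of_parallelK hF₁ hdF
      by_cases hbm : b = m
      · subst hbm
        exact pcK_junction ihSP h₂ hd (subset_trans (by intro e he; clear * - he; simp only [Finset.mem_union] at he ⊢; tauto) hN) hV hF₁ hF₂ hdF hVF hxF₂ hyF₁ hE hC hs ht (Ne.symm hbs) hsx hsy (Ne.symm hbt) htx hty hst
      by_cases hsm : s = m
      · subst hsm
        exact (pcK_junction ihSP h₂ hd (subset_trans (by intro e he; clear * - he; simp only [Finset.mem_union] at he ⊢; tauto) hN) hV hF₁ hF₂ hdF hVF hxF₂ hyF₁ hE hC hb ht hbs hbx hby (Ne.symm hst) htx hty hbt).swap12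
      by_cases htm : t = m
      · subst htm
        exact (pcK_junction ihSP h₂ hd (subset_trans (by intro e he; clear * - he; simp only [Finset.mem_union] at he ⊢; tauto) hN) hV hF₁ hF₂ hdF hVF hxF₂ hyF₁ hE hC hb hs hbt hbx hby hst hsx hsy hbs).rotate
      obtain ⟨hA, hdA, hVA⟩ := rerootK_serA h₂ hd hV hF₁ hF₂ hdF hVF hxF₂ hyF₁
      have hVA' : ∀ z : V, (∃ e ∈ F₁, z ∈ e) → (∃ e ∈ F₂ ∪ E₂, z ∈ e) → z = x ∨ z = m :=
        fun z h1 h => (hVA z h1 h).symm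
      obtain ⟨hB, hdB, hVB⟩ := rerootK_serB h₂ hd hV hF₁ hF₂ hdF hVF hxF₂ hyF₁
      have eA : F₁ ∪ F₂ ∪ E₂ = F₁ ∪ (F₂ ∪ E₂) := Finset.union_assoc _ _ _
      have eB : F₁ ∪ F₂ ∪ E₂ = F₂ ∪ (F₁ ∪ E₂) := by ac_rfl
      have hEA := eA ▸ hE; have hCA := eA ▸ hC; have hEB := eB ▸ hE; have hCB := eB ▸ hC
      have l1 : ∀ {p : V}, (∃ e ∈ F₁, p ∈ e) → ∃ e ∈ F₁ ∪ E₂, p ∈ e := fun ⟨e, he, hpe⟩ =>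
        ⟨e, Finset.mem_union_left _ he, hpe⟩
      have l2 : ∀ {p : V}, (∃ e ∈ F₂, p ∈ e) → ∃ e ∈ F₂ ∪ E₂, p ∈ e := fun ⟨e, he, hpe⟩ =>
        ⟨e, Finset.mem_union_left _ he, hpe⟩
      rcases span_union hb with hb1 | hb2 <;> rcases span_union hs with hs1 | hs2 <;>
        rcases span_union ht with ht1 | ht2
      · exact ih (by omega) hF₁ hA.symm hdA (subset_trans (by intro e he; clear * - he; simp only [Finset.mem_union] at he ⊢; tauto) hN) hVA' hEA hCA hb1 hs1 ht1 hbx hbm hsx hsm htx htm hbs hbt hst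
      · exact (typeIK_good ihSP _ le_rfl hF₁ hA.symm hdA (subset_trans (by intro e he; clear * - he; simp only [Finset.mem_union] at he ⊢; tauto) hN) hVA' hEA hCA hb1 hs1 (l2 ht2) hbx hbm hsx hsm htx htm hbs).rotate
      · exact (typeIK_good ihSP _ le_rfl hF₁ hA.symm hdA (subset_trans (by intro e he; clear * - he; simp only [Finset.mem_union] at he ⊢; tauto) hN) hVA' hEA hCA hb1 ht1 (l2 hs2) hbx hbm htx htm hsx hsm
          hbt).rotate.swap23
      · exact typeIK_good ihSP _ le_rfl hF₂ hB hdB (subset_trans (by intro e he; clear * - he; simp only [Finset.mem_union] at he ⊢; tauto) hN) hVB hEB hCB hs2 ht2 (l1 hb1) hsm hsy htm hty hbm hby hst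
      · exact typeIK_good ihSP _ le_rfl hF₁ hA.symm hdA (subset_trans (by intro e he; clear * - he; simp only [Finset.mem_union] at he ⊢; tauto) hN) hVA' hEA hCA hs1 ht1 (l2 hb2) hsx hsm htx htm hbx hbm hst
      · exact (typeIK_good ihSP _ le_rfl hF₂ hB hdB (subset_trans (by intro e he; clear * - he; simp only [Finset.mem_union] at he ⊢; tauto) hN) hVB hEB hCB hb2 ht2 (l1 hs1) hbm hby htm hty hsm hsy hbt).rotate.swap23
      · exact (typeIK_good ihSP _ le_rfl hF₂ hB hdB (subset_trans (by intro e he; clear * - he; simp only [Finset.mem_union] at he ⊢; tauto) hN) hVB hEB hCB hb2 hs2 (l1 ht1) hbm hby hsm hsy htm hty hbs).rotate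
      · exact ih (by omega) hF₂ hB hdB (subset_trans (by intro e he; clear * - he; simp only [Finset.mem_union] at he ⊢; tauto) hN) hVB hEB hCB hb2 hs2 ht2 hbm hby hsm hsy htm hty hbs hbt hst

    | @bridge Qac Qad Qbc Qbd Qcd _ _ c d hac had hbc hbd hcd hsep =>
      -- census g41: BRIDGE side with three inner marks — «Pat3KNetSPBridgePcD2» `pcK_bridge_dispatch` (views + type I + pb +
      -- CORNER + 𝒯₂(𝒦) + ih), modulo the five `pc` K-state leaf SPECs of «Pat3KNetSPLeavesI» (draft).
      exact pcK_bridge_dispatch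
        (fun h1 h2 hd' hN' hV' hE' hC' hs' ht' hb' hsx' hsy' htx' hty' hbx' hby' hst' =>
          typeIK_good ihSP _ le_rfl h1 h2 hd' hN' hV' hE' hC' hs' ht' hb' hsx' hsy' htx' hty' hbx' hby' hst')
        (fun h1 h2 hd' hN' hV' hE' hC' hs' ht' hsx' hsy' htx' hty' hst' =>
          pbK_good ihSP _ le_rfl h1 h2 hd' hN' hV' hE' hC' hs' ht' hsx' hsy' htx' hty' hst')
        (fun hc h1 h2 hd' hN' hV' hE' hC' hb' hs' ht' => ih hc h1 h2 hd' hN' hV' hE' hC' hb' hs' ht')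
        (spGoodC_bridgeLeaf_tri3 ihSP) (spGoodC_bridgeLeaf_claw3 ihSP) (spGoodC_bridgeLeaf_pathA ihSP) (spGoodC_bridgeLeaf_pathB ihSP) (spGoodC_bridgeLeaf_vee3 ihSP)
        hac had hbc hbd hcd hsep h₂ hd hN hV hE hC hcard hb hs ht hbx hby hsx hsy htx hty hbs hbt hst
end AllInnerC

/-! ### The parallel case of the main induction on minors, by the number of marked terminals -/

section ParallelCaseC

variable {Q₁ Q₂ : Finset (Sym2 V)} {x y : V} {E C : Finset (Sym2 V)}

variable {N₀ : Finset (Sym2 V)}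
  (ihSP : ∀ {N' E' C' : Finset (Sym2 V)} {x' y' b' s' t' : V}, N'.card < N₀.card → IsKNet N' x' y' → E' ⊆ N' → C' ⊆ N' →
    (∃ e ∈ N', b' ∈ e) → (∃ e ∈ N', s' ∈ e) → (∃ e ∈ N', t' ∈ e) → b' ≠ s' → b' ≠ t' → s' ≠ t' → SPGoodC E' C' b' s' t')

/-- Both terminals marked, the third mark inner, on minors. [cite: AyyerLinussonRavichandran2025, §7 (p. 22)] -/
theorem parK_twoTerm {r : V} (hQ₁ : IsKNet Q₁ x y) (hQ₂ : IsKNet Q₂ x y) (hdQ : Disjoint Q₁ Q₂)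
    (hVQ : ∀ z : V, (∃ e ∈ Q₁, z ∈ e) → (∃ e ∈ Q₂, z ∈ e) → z = x ∨ z = y)
    (hE : E ⊆ Q₁ ∪ Q₂) (hC : C ⊆ Q₁ ∪ Q₂)
    (hr : ∃ e ∈ Q₁ ∪ Q₂, r ∈ e) (hrx : r ≠ x) (hry : r ≠ y) : SPGoodC E C x y r := by
  have iE : ∀ A : Finset (Sym2 V), E ∩ A ⊆ A := fun A => Finset.inter_subset_right
  have iC : ∀ A : Finset (Sym2 V), C ∩ A ⊆ A := fun A => Finset.inter_subset_right
  rcases span_union hr with hr1 | hr2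
  · have eB : Q₁ ∪ Q₂ = Q₂ ∪ Q₁ := Finset.union_comm _ _
    exact (spGoodC_parTwoK hdQ.symm (fun z h2 h1 => hVQ z h1 h2) hQ₁.ne hQ₁ (iE _) (iC _) (iE _) (iC _) hr1 hrx
      hry).congr_sets (inter_union2_eq hE eB) (inter_union2_eq hC eB)
  · exact (spGoodC_parTwoK hdQ hVQ hQ₁.ne hQ₂ (iE _) (iC _) (iE _) (iC _) hr2 hrx hry).congr_sets (inter_union2_eq hE rfl)
      (inter_union2_eq hC rfl)

include ihSP in
/-- Exactly the terminal `x` marked, the other two marks inner, on minors. [cite: AyyerLinussonRavichandran2025, §7 (p. 22)] -/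
theorem parK_oneTerm {p q : V} (hQ₁ : IsKNet Q₁ x y) (hQ₂ : IsKNet Q₂ x y) (hdQ : Disjoint Q₁ Q₂) (hN : Q₁ ∪ Q₂ ⊆ N₀)
    (hVQ : ∀ z : V, (∃ e ∈ Q₁, z ∈ e) → (∃ e ∈ Q₂, z ∈ e) → z = x ∨ z = y)
    (hE : E ⊆ Q₁ ∪ Q₂) (hC : C ⊆ Q₁ ∪ Q₂)
    (hp : ∃ e ∈ Q₁ ∪ Q₂, p ∈ e) (hq : ∃ e ∈ Q₁ ∪ Q₂, q ∈ e) (hpx : p ≠ x) (hpy : p ≠ y) (hqx : q ≠ x) (hqy : q ≠ y)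
    (hpq : p ≠ q) : SPGoodC E C x p q := by
  have iE : ∀ A : Finset (Sym2 V), E ∩ A ⊆ A := fun A => Finset.inter_subset_right
  have iC : ∀ A : Finset (Sym2 V), C ∩ A ⊆ A := fun A => Finset.inter_subset_right
  have eB : Q₁ ∪ Q₂ = Q₂ ∪ Q₁ := Finset.union_comm _ _
  rcases span_union hp with hp1 | hp2 <;> rcases span_union hq with hq1 | hq2
  · exact pbK_good ihSP Q₁.card le_rfl hQ₁ hQ₂ hdQ (subset_trans (by intro e he; clear * - he; simp only [Finset.mem_union] at he ⊢; tauto) hN) hVQ hE hC hp1 hq1 hpx hpy hqx hqy hpq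
  · exact (spGoodC_cornerK hdQ hVQ hQ₁ hQ₂ (iE _) (iC _) (iE _) (iC _) hp1 hq2 hpx hpy hqx hqy).congr_sets
      (inter_union2_eq hE rfl) (inter_union2_eq hC rfl)
  · exact (spGoodC_cornerK hdQ hVQ hQ₁ hQ₂ (iE _) (iC _) (iE _) (iC _) hq1 hp2 hqx hqy hpx hpy).swap23.congr_sets
      (inter_union2_eq hE rfl) (inter_union2_eq hC rfl)
  · exact pbK_good ihSP Q₂.card le_rfl hQ₂ hQ₁ hdQ.symm (subset_trans (by intro e he; clear * - he; simp only [Finset.mem_union] at he ⊢; tauto) hN) (fun z h2 h1 => hVQ z h1 h2) (eB ▸ hE) (eB ▸ hC) hp2 hq2 hpx hpy hqx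
      hqy hpq

include ihSP in
/-- No terminal marked: all three marks inner, on minors. [cite: AyyerLinussonRavichandran2025, §7 (p. 22)] -/
theorem parK_noTerm {b s t : V} (hQ₁ : IsKNet Q₁ x y) (hQ₂ : IsKNet Q₂ x y) (hdQ : Disjoint Q₁ Q₂) (hN : Q₁ ∪ Q₂ ⊆ N₀)
    (hVQ : ∀ z : V, (∃ e ∈ Q₁, z ∈ e) → (∃ e ∈ Q₂, z ∈ e) → z = x ∨ z = y)
    (hE : E ⊆ Q₁ ∪ Q₂) (hC : C ⊆ Q₁ ∪ Q₂)
    (hb : ∃ e ∈ Q₁ ∪ Q₂, b ∈ e) (hs : ∃ e ∈ Q₁ ∪ Q₂, s ∈ e) (ht : ∃ e ∈ Q₁ ∪ Q₂, t ∈ e)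
    (hbx : b ≠ x) (hby : b ≠ y) (hsx : s ≠ x) (hsy : s ≠ y) (htx : t ≠ x) (hty : t ≠ y)
    (hbs : b ≠ s) (hbt : b ≠ t) (hst : s ≠ t) : SPGoodC E C b s t := by
  have hdQ' : Disjoint Q₂ Q₁ := hdQ.symm
  have hVQ' : ∀ z : V, (∃ e ∈ Q₂, z ∈ e) → (∃ e ∈ Q₁, z ∈ e) → z = x ∨ z = y := fun z h2 h1 => hVQ z h1 h2
  have eB : Q₁ ∪ Q₂ = Q₂ ∪ Q₁ := Finset.union_comm _ _
  have hEB := eB ▸ hE; have hCB := eB ▸ hC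
  rcases span_union hb with hb1 | hb2 <;> rcases span_union hs with hs1 | hs2 <;> rcases span_union ht with ht1 | ht2
  · exact pcK_good ihSP Q₁.card le_rfl hQ₁ hQ₂ hdQ (subset_trans (by intro e he; clear * - he; simp only [Finset.mem_union] at he ⊢; tauto) hN) hVQ hE hC hb1 hs1 ht1 hbx hby hsx hsy htx hty hbs hbt hst
  · exact (typeIK_good ihSP Q₁.card le_rfl hQ₁ hQ₂ hdQ (subset_trans (by intro e he; clear * - he; simp only [Finset.mem_union] at he ⊢; tauto) hN) hVQ hE hC hb1 hs1 ht2 hbx hby hsx hsy htx hty hbs).rotate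
  · exact (typeIK_good ihSP Q₁.card le_rfl hQ₁ hQ₂ hdQ (subset_trans (by intro e he; clear * - he; simp only [Finset.mem_union] at he ⊢; tauto) hN) hVQ hE hC hb1 ht1 hs2 hbx hby htx hty hsx hsy hbt).rotate.swap23
  · exact typeIK_good ihSP Q₂.card le_rfl hQ₂ hQ₁ hdQ' (subset_trans (by intro e he; clear * - he; simp only [Finset.mem_union] at he ⊢; tauto) hN) hVQ' hEB hCB hs2 ht2 hb1 hsx hsy htx hty hbx hby hst
  · exact typeIK_good ihSP Q₁.card le_rfl hQ₁ hQ₂ hdQ (subset_trans (by intro e he; clear * - he; simp only [Finset.mem_union] at he ⊢; tauto) hN) hVQ hE hC hs1 ht1 hb2 hsx hsy htx hty hbx hby hst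
  · exact (typeIK_good ihSP Q₂.card le_rfl hQ₂ hQ₁ hdQ' (subset_trans (by intro e he; clear * - he; simp only [Finset.mem_union] at he ⊢; tauto) hN) hVQ' hEB hCB hb2 ht2 hs1 hbx hby htx hty hsx hsy hbt).rotate.swap23
  · exact (typeIK_good ihSP Q₂.card le_rfl hQ₂ hQ₁ hdQ' (subset_trans (by intro e he; clear * - he; simp only [Finset.mem_union] at he ⊢; tauto) hN) hVQ' hEB hCB hb2 hs2 ht1 hbx hby hsx hsy htx hty hbs).rotate
  · exact pcK_good ihSP Q₂.card le_rfl hQ₂ hQ₁ hdQ' (subset_trans (by intro e he; clear * - he; simp only [Finset.mem_union] at he ⊢; tauto) hN) hVQ' hEB hCB hb2 hs2 ht2 hbx hby hsx hsy htx hty hbs hbt hst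

include ihSP in
/-- One marked terminal `x` and two further distinct marks anywhere else, on minors. [cite: AyyerLinussonRavichandran2025, §7 (p. 22)] -/
theorem parK_termFirst {p q : V} (hQ₁ : IsKNet Q₁ x y) (hQ₂ : IsKNet Q₂ x y) (hdQ : Disjoint Q₁ Q₂) (hN : Q₁ ∪ Q₂ ⊆ N₀)
    (hVQ : ∀ z : V, (∃ e ∈ Q₁, z ∈ e) → (∃ e ∈ Q₂, z ∈ e) → z = x ∨ z = y)
    (hE : E ⊆ Q₁ ∪ Q₂) (hC : C ⊆ Q₁ ∪ Q₂)
    (hp : ∃ e ∈ Q₁ ∪ Q₂, p ∈ e) (hq : ∃ e ∈ Q₁ ∪ Q₂, q ∈ e) (hpx : p ≠ x) (hqx : q ≠ x) (hpq : p ≠ q) :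
    SPGoodC E C x p q := by
  by_cases hpy : p = y
  · subst hpy
    exact (parK_twoTerm hQ₁ hQ₂ hdQ hVQ hE hC hq hqx (Ne.symm hpq)).swap23.swap23
  by_cases hqy : q = y
  · subst hqy
    exact (parK_twoTerm hQ₁ hQ₂ hdQ hVQ hE hC hp hpx hpy).swap23
  exact parK_oneTerm ihSP hQ₁ hQ₂ hdQ hN hVQ hE hC hp hq hpx hpy hqx hqy hpq

include ihSP in
/-- **THE PARALLEL CASE ON MINORS:** on a parallel composition of two bridge–series–parallel networks (class 𝒦), every minor `(E, C)`
and every placement of three distinct marks is good. [cite: AyyerLinussonRavichandran2025, §7 (p. 22)] -/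
theorem spGoodC_parallelK {b s t : V} (hQ₁ : IsKNet Q₁ x y) (hQ₂ : IsKNet Q₂ x y) (hdQ : Disjoint Q₁ Q₂) (hN : Q₁ ∪ Q₂ ⊆ N₀)
    (hVQ : ∀ z : V, (∃ e ∈ Q₁, z ∈ e) → (∃ e ∈ Q₂, z ∈ e) → z = x ∨ z = y)
    (hE : E ⊆ Q₁ ∪ Q₂) (hC : C ⊆ Q₁ ∪ Q₂)
    (hb : ∃ e ∈ Q₁ ∪ Q₂, b ∈ e) (hs : ∃ e ∈ Q₁ ∪ Q₂, s ∈ e) (ht : ∃ e ∈ Q₁ ∪ Q₂, t ∈ e)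
    (hbs : b ≠ s) (hbt : b ≠ t) (hst : s ≠ t) : SPGoodC E C b s t := by
  have hVQ' : ∀ z : V, (∃ e ∈ Q₁, z ∈ e) → (∃ e ∈ Q₂, z ∈ e) → z = y ∨ z = x := fun z h1 h2 => (hVQ z h1 h2).symm
  by_cases hbx : b = x
  · subst hbx
    exact parK_termFirst ihSP hQ₁ hQ₂ hdQ hN hVQ hE hC hs ht (Ne.symm hbs) (Ne.symm hbt) hst
  by_cases hby : b = y
  · subst hby
    exact parK_termFirst ihSP hQ₁.symm hQ₂.symm hdQ hN hVQ' hE hC hs ht (Ne.symm hbs) (Ne.symm hbt) hst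
  by_cases hsx : s = x
  · subst hsx
    exact (parK_termFirst ihSP hQ₁ hQ₂ hdQ hN hVQ hE hC hb ht hbx (Ne.symm hst) hbt).swap12
  by_cases hsy : s = y
  · subst hsy
    exact (parK_termFirst ihSP hQ₁.symm hQ₂.symm hdQ hN hVQ' hE hC hb ht hby (Ne.symm hst) hbt).swap12
  by_cases htx : t = x
  · subst htx
    exact (parK_termFirst ihSP hQ₁ hQ₂ hdQ hN hVQ hE hC hb hs hbx hsx hbs).rotate
  by_cases hty : t = y
  · subst hty
    exact (parK_termFirst ihSP hQ₁.symm hQ₂.symm hdQ hN hVQ' hE hC hb hs hby hsy hbs).rotate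
  exact parK_noTerm ihSP hQ₁ hQ₂ hdQ hN hVQ hE hC hb hs ht hbx hby hsx hsy htx hty hbs hbt hst

end ParallelCaseC

end FK

end Summit.CriticalPhenomena.PercolationContinuityZ3.Theorems
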